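import Literature.NumberTheory.EllipticCurves.H1UnramifiedFinite
import Literature.NumberTheory.EllipticCurves.KummerHomsFinite
import Mathlib.GroupTheory.FiniteAbelian.Basic
import Mathlib.RingTheory.Polynomial.Cyclotomic.Roots
import HarnessLib

/-!
# Finiteness of `Hom(U, M; S)` (Silverman AEC Prop. VIII.1.6, `Hom` form) and of `H¹(G_K, M; S)`
# (Lemma X.4.3): discharge of `Literature.NumberTheory.EllipticCurves.finite_unramifiedHoms` and `Literature.NumberTheory.EllipticCurves.finite_h1Unramified`

`Proofs` companion of `H1UnramifiedFinite` (and, through it, of the Lemma X.4.3 fact of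
`SelmerUnramified`). It discharges the named fact `Literature.finite_unramifiedHoms K` of
`H1UnramifiedFinite`
(Silverman, *The Arithmetic of Elliptic Curves*, 2nd ed., Prop. VIII.1.6 in the `Hom` form used in
the proof of Lemma X.4.3): for a number field `K`, an open subgroup `U ≤ G_K = Gal(K̄/K)`, a finite
abelian group `M` and a finite set `S` of finite places of `K`, the set `Hom(U, M; S)` of continuous
homomorphisms `U → M` vanishing on `I_𝔓 ∩ U` for all primes `𝔓 ∣ v ∉ S` of `\bar ℤ_K` is finite
(`Literature.NumberTheory.EllipticCurves.finite_unramifiedHoms_holds`); together with the proved reduction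
`Literature.NumberTheory.EllipticCurves.finite_h1Unramified_of_finite_unramifiedHoms` this proves **Lemma X.4.3**,
`Literature.NumberTheory.EllipticCurves.finite_h1Unramified_holds`: `H¹(G_{K̄/K}, M; S)` is finite for every finite discrete
`G_K`-module `M` with continuous action and every finite `S`.

The arithmetic was done in `KummerHomsFinite` (`Literature.NumberTheory.EllipticCurves.finite_kummerUnramifiedHoms`: Prop. VIII.1.6
for characters `Gal(Ω/k) → ℤ/dℤ` of a Galois pair `(k, Ω)` with `μ_d ⊆ k`, via Kummer theory /
Hilbert 90, the criterion `unramified ⟹ d ∣ ord_w(a)` of `KummerUnramified`, and the finiteness of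
`k(S, d)` of `KummerSelmerGroupFinite`). Here we perform the reductions of Silverman's proofs of
VIII.1.6 ("it suffices to prove the proposition under the assumption that `K` contains `μ_m`") and
X.4.3 ("it suffices to prove the lemma with `K` replaced by a finite extension"):

* `Literature.NumberTheory.EllipticCurves.unramifiedHoms_finite_of_le`: shrinking `U` to an open `U' ≤ U` (finite index):
  `f ↦ (f|_{U'}, f on coset representatives)` is injective;
* `Literature.NumberTheory.EllipticCurves.unramifiedHoms_finite_of_forall_comp`: `M ↪ ∏ᵢ Mᵢ` by finitely many additive maps that
  jointly separate points reduces to the `Mᵢ`; by the structure theorem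
  (`AddCommGroup.equiv_directSum_zmod_of_finite`) one may take `Mᵢ = ℤ/dᵢℤ`;
* `Literature.NumberTheory.EllipticCurves.unramifiedHoms_fixingSubgroup_finite`: for `U' = Gal(K̄/K')` with `K'/K` finite,
  `μ_d ⊆ K'` and `M ↪ ℤ/dℤ`, transport along `Gal(K̄/K') ≅ K̄ ≃ₐ[K'] K̄`
  (`IntermediateField.fixingSubgroupEquiv`) and `\bar ℤ_K = \bar ℤ_{K'}` (same subring of `K̄`)
  to `Literature.NumberTheory.EllipticCurves.finite_kummerUnramifiedHoms` for `(k, Ω) = (K', K̄)` and the places of `K'` above `S`;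
* assembly: `K' = (K̄)^U · K(ζ_N)` for `N = ∏ dᵢ`.

## Mathlib reuse

`AddCommGroup.equiv_directSum_zmod_of_finite`, `Subgroup.quotient_finite_of_isOpen`,
`QuotientGroup.mk_out_eq_mul`, `krullTopology_mem_nhds_one_iff`, `InfiniteGalois.isOpen_iff_finite`,
`InfiniteGalois.fixingSubgroup_fixedField`, `IntermediateField.fixingSubgroupEquiv`,
`IntermediateField.extendScalars`, `IsDedekindDomain.HeightOneSpectrum.under`,
`IsDedekindDomain.primesOver_finite`, `Polynomial.isRoot_cyclotomic_iff`, `IsPrimitiveRoot.pow`.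
-/

noncomputable section

open scoped Classical
open scoped Pointwise IntermediateField NumberField

open NumberField IsDedekindDomain IntermediateField Field

universe u

namespace Literature.NumberTheory.EllipticCurves

/-! ## Reductions -/

section Reductions

variable {K : Type u} [Field K]

/-- **Shrinking `U`.** If `U' ≤ U ≤ G_K` with `U` closed and `U'` open (so `U'` has finite index
in `U`), then finiteness of `Hom(U', M; S)` implies finiteness of `Hom(U, M; S)`: a homomorphism on
`U` is determined by its restriction to `U'` and its values on coset representatives of `U/U'`
(`f (g u') = f g + f u'`). Silverman, *AEC*, proof of Prop. VIII.1.6, first reduction ("suppose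
that we know the proposition is true for some finite extension `K'` of `K` … then `L/K` would also
be finite"). [folklore] -/
theorem unramifiedHoms_finite_of_le [CharZero K] {U U' : Subgroup (absoluteGaloisGroup K)}
    (hle : U' ≤ U) (hU : IsClosed (U : Set (absoluteGaloisGroup K)))
    (hU' : IsOpen (U' : Set (absoluteGaloisGroup K))) (M : Type u) [AddCommGroup M] [Finite M]
    [TopologicalSpace M] (S : Set (HeightOneSpectrum (𝓞 K)))
    (h : (unramifiedHoms U' M S).Finite) : (unramifiedHoms U M S).Finite := by
  -- `U'` as an open subgroup of the compact group `U`
  haveI : CompactSpace U := isCompact_iff_compactSpace.mp hU.isCompact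
  let V : Subgroup U := U'.subgroupOf U
  have hV : IsOpen (V : Set U) := hU'.preimage continuous_subtype_val
  haveI : Finite (U ⧸ V) := Subgroup.quotient_finite_of_isOpen V hV
  -- restriction to `U'` and evaluation at coset representatives
  let res : (U → M) → (U' → M) := fun f u' ↦ f ⟨u', hle u'.2⟩
  let ev : (U → M) → (U ⧸ V → M) := fun f q ↦ f q.out
  have hinj : Set.InjOn (fun f ↦ (res f, ev f)) (unramifiedHoms U M S) := by
    intro f hf g hg hfg
    simp only [Prod.mk.injEq] at hfg
    obtain ⟨hres, hev⟩ := hfg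
    funext u
    obtain ⟨v, hv⟩ := QuotientGroup.mk_out_eq_mul V u
    have hfu : f (QuotientGroup.mk (s := V) u).out = f u + f v := by rw [hv, hf.2.1]
    have hgu : g (QuotientGroup.mk (s := V) u).out = g u + g v := by rw [hv, hg.2.1]
    have hv' : f v = g v := by
      have := congr_fun hres ⟨(v : U), v.2⟩
      exact this
    have := congr_fun hev (QuotientGroup.mk (s := V) u)
    change f (QuotientGroup.mk (s := V) u).out = g (QuotientGroup.mk (s := V) u).out at this
    rw [hfu, hgu, hv'] at this
    exact add_right_cancel this
  refine Set.Finite.of_finite_image (Set.Finite.subset (h.prod (Set.finite_univ)) ?_) hinj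
  rintro _ ⟨f, hf, rfl⟩
  refine ⟨⟨?_, fun σ τ ↦ ?_, fun v hv 𝔓 h𝔓 σ hσ ↦ ?_⟩, Set.mem_univ _⟩
  · exact hf.1.comp (Continuous.subtype_mk continuous_subtype_val _)
  · exact hf.2.1 ⟨σ, hle σ.2⟩ ⟨τ, hle τ.2⟩
  · exact hf.2.2 v hv 𝔓 h𝔓 ⟨σ, hle σ.2⟩ hσ

/-- **Decomposing `M`.** If finitely many continuous additive maps `πᵢ : M → Mᵢ` jointly separate
the points of `M`, then finiteness of all `Hom(U, Mᵢ; S)` implies finiteness of `Hom(U, M; S)`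
(`f ↦ (πᵢ ∘ f)ᵢ` is injective). Silverman, *AEC*, X.§4, proof of Lemma 4.3 (reduction to a
cyclic `M`, implicit in "let `m` be the exponent of `M` … `Hom(G, M; S)`"). [folklore] -/
theorem unramifiedHoms_finite_of_forall_comp {U : Subgroup (absoluteGaloisGroup K)} {M : Type u}
    [AddCommGroup M] [TopologicalSpace M] {ι : Type*} [Finite ι] {N : ι → Type u}
    [∀ i, AddCommGroup (N i)] [∀ i, TopologicalSpace (N i)] (π : ∀ i, M →+ N i)
    (hπc : ∀ i, Continuous (π i)) (hπ : ∀ m : M, (∀ i, π i m = 0) → m = 0)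
    (S : Set (HeightOneSpectrum (𝓞 K))) (h : ∀ i, (unramifiedHoms U (N i) S).Finite) :
    (unramifiedHoms U M S).Finite := by
  let Φ : (U → M) → (∀ i, U → N i) := fun f i u ↦ π i (f u)
  have hinj : Set.InjOn Φ (unramifiedHoms U M S) := by
    intro f hf g hg hfg
    funext u
    rw [← sub_eq_zero]
    apply hπ
    intro i
    have := congr_fun (congr_fun hfg i) u
    change π i (f u) = π i (g u) at this
    rw [map_sub, this, sub_self]
  refine Set.Finite.of_finite_image (Set.Finite.subset (Set.Finite.pi h) ?_) hinj
  rintro _ ⟨f, hf, rfl⟩ i -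
  refine ⟨(hπc i).comp hf.1, fun σ τ ↦ ?_, fun v hv 𝔓 h𝔓 σ hσ ↦ ?_⟩
  · change π i (f (σ * τ)) = π i (f σ) + π i (f τ)
    rw [hf.2.1, map_add]
  · change π i (f σ) = 0
    rw [hf.2.2 v hv 𝔓 h𝔓 σ hσ, map_zero]

omit [Field K] in
/-- **Structure theorem, in the form needed.** A finite abelian group `M` admits finitely many
additive maps `M → ℤ/dᵢℤ` (`dᵢ ≥ 1`) which jointly separate points, with all `dᵢ` dividing one
`N ≥ 1` (project `M ≅ ⊕ᵢ ℤ/pᵢ^{eᵢ}ℤ`, `AddCommGroup.equiv_directSum_zmod_of_finite`, to its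
factors; `N = ∏ dᵢ`). [folklore] -/
theorem exists_separating_toZMod (M : Type u) [AddCommGroup M] [Finite M] :
    ∃ (ι : Type) (_ : Fintype ι) (d : ι → ℕ) (N : ℕ), 0 < N ∧ (∀ i, 0 < d i) ∧ (∀ i, d i ∣ N) ∧
      ∃ π : ∀ i, M →+ ULift.{u} (ZMod (d i)), ∀ m : M, (∀ i, π i m = 0) → m = 0 := by
  obtain ⟨ι, hι, p, hp, e, ⟨φ⟩⟩ := AddCommGroup.equiv_directSum_zmod_of_finite M
  refine ⟨ι, hι, fun i ↦ p i ^ e i, ∏ i, p i ^ e i, ?_, fun i ↦ ?_, fun i ↦ ?_, ?_⟩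
  · exact Finset.prod_pos fun i _ ↦ pow_pos (hp i).pos _
  · exact pow_pos (hp i).pos _
  · exact Finset.dvd_prod_of_mem _ (Finset.mem_univ i)
  · refine ⟨fun i ↦ (AddEquiv.ulift.symm.toAddMonoidHom.comp
      ((DirectSum.component ℤ ι (fun i ↦ ZMod (p i ^ e i)) i).toAddMonoidHom)).comp
        φ.toAddMonoidHom, fun m hm ↦ ?_⟩
    apply φ.injective
    rw [map_zero]
    refine DirectSum.ext_component ℤ fun i ↦ ?_
    have := hm i
    change AddEquiv.ulift.symm (DirectSum.component ℤ ι (fun i ↦ ZMod (p i ^ e i)) i (φ m)) = 0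
      at this
    rw [map_zero]
    exact AddEquiv.ulift.symm.injective (by rw [this, map_zero])

end Reductions

/-! ## The cyclic case over a finite extension `K'` -/

section FixingSubgroup

variable {K : Type u} [Field K] [NumberField K]

/-- The set of places of a finite extension `K' ⊆ K̄` of `K` lying above a finite set `S` of places
of `K` is finite (each `v` has finitely many primes above it, `IsDedekindDomain.primesOver_finite`).
Silverman, *AEC*, proof of Prop. VIII.1.6 ("where `S'` is the set of places of `K'` lying over
`S`"). [folklore] -/
theorem finite_setOf_under_mem (K' : IntermediateField K (AlgebraicClosure K))
    [FiniteDimensional K K'] {S : Set (HeightOneSpectrum (𝓞 K))} (hS : S.Finite) :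
    {w : HeightOneSpectrum (𝓞 K') | HeightOneSpectrum.under (𝓞 K) w ∈ S}.Finite := by
  haveI : NumberField K' := NumberField.of_module_finite K K'
  have hsub : {w : HeightOneSpectrum (𝓞 K') | HeightOneSpectrum.under (𝓞 K) w ∈ S} ⊆
      ⋃ v ∈ S, {w : HeightOneSpectrum (𝓞 K') | w.asIdeal ∈ v.asIdeal.primesOver (𝓞 K')} := by
    intro w hw
    simp only [Set.mem_iUnion, Set.mem_setOf_eq]
    exact ⟨_, hw, w.isPrime, ⟨rfl⟩⟩
  refine Set.Finite.subset (Set.Finite.biUnion hS fun v _ ↦ ?_) hsub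
  haveI := v.isMaximal
  exact Set.Finite.of_finite_image
    ((IsDedekindDomain.primesOver_finite v.asIdeal (𝓞 K')).subset (by
      rintro _ ⟨w, hw, rfl⟩
      exact hw))
    (fun w _ w' _ h ↦ HeightOneSpectrum.ext h)

omit [NumberField K] in
/-- The ring `\bar ℤ_K = absIntegers (𝓞 K) K` of algebraic integers of `K̄` is contained in (in
fact equal to) the integral closure of `𝓞 K'` in `K̄` for every subextension `K'/K`. [folklore] -/
theorem absIntegers_le_integralClosure (K' : IntermediateField K (AlgebraicClosure K)) :
    (GaloisRepresentations.absIntegers (𝓞 K) K).toSubring ≤ (integralClosure (𝓞 K') (AlgebraicClosure K)).toSubring := by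
  intro x hx
  change IsIntegral (𝓞 K') x
  have hx' : IsIntegral (𝓞 K) x := hx
  exact (isIntegral_trans (R := ℤ) x hx').tower_top

/-- **Prop. VIII.1.6 (`Hom` form) for `U = Gal(K̄/K')`, cyclic coefficients.** Let `K'/K` be a
finite subextension of `K̄` containing a primitive `d`-th root of unity, `M` a discrete abelian
group embedding into `ℤ/dℤ`, and `S` a finite set of places of `K`. Then
`Hom(Gal(K̄/K'), M; S)` (`Literature.NumberTheory.EllipticCurves.unramifiedHoms` for the fixing subgroup of `K'` in `G_K`) is finite:
transporting along `Gal(K̄/K') ≅ K̄ ≃ₐ[K'] K̄` and `\bar ℤ_K ⊆ \bar ℤ_{K'}` identifies it with a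
set of characters of `Gal(K̄/K')` unramified outside the places of `K'` above `S`, finite by
`Literature.NumberTheory.EllipticCurves.finite_kummerUnramifiedHoms`. Silverman, *AEC*, Prop. VIII.1.6 and X.§4 (proof of
Lemma 4.3). [cite: SilvermanAEC2009, Prop. VIII.1.6] -/
theorem unramifiedHoms_fixingSubgroup_finite (K' : IntermediateField K (AlgebraicClosure K))
    [FiniteDimensional K K'] {d : ℕ} (hd : 0 < d) {ζ : K'} (hζ : IsPrimitiveRoot ζ d)
    (M : Type u) [AddCommGroup M] [TopologicalSpace M] [DiscreteTopology M]
    (j : M →+ ZMod d) (hj : Function.Injective j)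
    {S : Set (HeightOneSpectrum (𝓞 K))} (hS : S.Finite) :
    (unramifiedHoms (K'.fixingSubgroup : Subgroup (absoluteGaloisGroup K)) M S).Finite := by
  classical
  haveI : NumberField K' := NumberField.of_module_finite K K'
  set U' : Subgroup (absoluteGaloisGroup K) := K'.fixingSubgroup with hU'def
  let e : U' ≃* (AlgebraicClosure K ≃ₐ[K'] AlgebraicClosure K) :=
    IntermediateField.fixingSubgroupEquiv K'
  have he : ∀ (τ : AlgebraicClosure K ≃ₐ[K'] AlgebraicClosure K) (x : AlgebraicClosure K),
      ((e.symm τ : U') : absoluteGaloisGroup K) • x = τ x := fun τ x ↦ rfl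
  -- transport of homomorphisms
  let T : (U' → M) → ((AlgebraicClosure K ≃ₐ[K'] AlgebraicClosure K) → ZMod d) :=
    fun f τ ↦ j (f (e.symm τ))
  have hT : Set.InjOn T (unramifiedHoms U' M S) := by
    intro f _ g _ hfg
    funext u
    apply hj
    have := congr_fun hfg (e u)
    change j (f (e.symm (e u))) = j (g (e.symm (e u))) at this
    rwa [e.symm_apply_apply] at this
  -- the places of `K'` above `S`
  let S' : Set (HeightOneSpectrum (𝓞 K')) := {w | HeightOneSpectrum.under (𝓞 K) w ∈ S}
  have hS' : S'.Finite := finite_setOf_under_mem K' hS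
  refine Set.Finite.of_finite_image ?_ hT
  refine finite_kummerUnramifiedHoms (k := K') (Ω := AlgebraicClosure K) hd hζ hS'
    (T '' unramifiedHoms U' M S) ?_ ?_ ?_
  · -- additivity
    rintro _ ⟨f, hf, rfl⟩ σ τ
    change j (f (e.symm (σ * τ))) = j (f (e.symm σ)) + j (f (e.symm τ))
    rw [map_mul, hf.2.1, map_add]
  · -- continuity ⟹ factors through a finite extension of `K'`
    rintro _ ⟨f, hf, rfl⟩
    have h0 : IsOpen (f ⁻¹' {0}) := (isOpen_discrete _).preimage hf.1
    obtain ⟨V, hVopen, hV⟩ := isOpen_induced_iff.mp h0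
    have h1 : (1 : absoluteGaloisGroup K) ∈ V ∩ (U' : Set (absoluteGaloisGroup K)) := by
      refine ⟨?_, U'.one_mem⟩
      have hf1 : f 1 = 0 := by
        have := hf.2.1 1 1
        rw [mul_one] at this
        exact left_eq_add.mp this
      have : (1 : U') ∈ Subtype.val ⁻¹' V := by
        rw [hV]
        exact hf1
      exact this
    have hW : V ∩ (U' : Set (absoluteGaloisGroup K)) ∈ nhds (1 : absoluteGaloisGroup K) :=
      (hVopen.inter (IntermediateField.fixingSubgroup_isOpen K')).mem_nhds h1
    obtain ⟨E, hEfin, hEsub⟩ :=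
      (krullTopology_mem_nhds_one_iff K (AlgebraicClosure K) _).mp hW
    haveI := hEfin
    let E' : IntermediateField K' (AlgebraicClosure K) :=
      IntermediateField.extendScalars (F := K') (E := K' ⊔ E) le_sup_left
    haveI : FiniteDimensional K' E' := by
      have hKE : FiniteDimensional K (IntermediateField.restrictScalars K E') := by
        rw [IntermediateField.extendScalars_restrictScalars]
        infer_instance
      haveI : Module.Finite K E' := hKE
      exact Module.Finite.of_restrictScalars_finite K K' E'
    refine ⟨E', inferInstance, fun τ hτ ↦ ?_⟩
    change j (f (e.symm τ)) = 0
    have hmemV : ((e.symm τ : U') : absoluteGaloisGroup K) ∈ V := by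
      refine (hEsub ?_).1
      rw [SetLike.mem_coe, IntermediateField.mem_fixingSubgroup_iff]
      intro x hx
      have hx' : x ∈ E' := (le_sup_right : E ≤ K' ⊔ E) hx
      exact (IntermediateField.mem_fixingSubgroup_iff _ _).mp hτ x hx'
    have : e.symm τ ∈ f ⁻¹' {0} := by
      rw [← hV]
      exact hmemV
    rw [this, map_zero]
  · -- unramified outside `S` ⟹ unramified outside `S'`
    rintro _ ⟨f, hf, rfl⟩ w hw 𝔓' h𝔓'max h𝔓'over τ hτ
    change j (f (e.symm τ)) = 0
    let v : HeightOneSpectrum (𝓞 K) := HeightOneSpectrum.under (𝓞 K) w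
    have hv : v ∉ S := hw
    let θ : GaloisRepresentations.absIntegers (𝓞 K) K →+* integralClosure (𝓞 K') (AlgebraicClosure K) :=
      Subring.inclusion (absIntegers_le_integralClosure K')
    have hθ : ∀ x, (θ x : AlgebraicClosure K) = x := fun x ↦ rfl
    let 𝔓 : Ideal (GaloisRepresentations.absIntegers (𝓞 K) K) := 𝔓'.comap θ
    haveI := h𝔓'max.isPrime
    have h𝔓 : 𝔓 ∈ v.primesAbove := by
      refine ⟨Ideal.comap_isPrime θ 𝔓', ⟨?_⟩⟩
      change (HeightOneSpectrum.under (𝓞 K) w).asIdeal =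
        Ideal.comap (algebraMap (𝓞 K) (GaloisRepresentations.absIntegers (𝓞 K) K)) (Ideal.comap θ 𝔓')
      rw [HeightOneSpectrum.under_asIdeal, Ideal.comap_comap, h𝔓'over.over, Ideal.under,
        Ideal.under, Ideal.comap_comap]
      congr 1
    have hσI : ((e.symm τ : U') : absoluteGaloisGroup K) ∈ 𝔓.inertia (absoluteGaloisGroup K) := by
      rw [Ideal.inertia, AddSubgroup.mem_inertia]
      intro x
      change θ (((e.symm τ : U') : absoluteGaloisGroup K) • x - x) ∈ 𝔓'
      have hθx : θ (((e.symm τ : U') : absoluteGaloisGroup K) • x) = τ • θ x := by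
        apply Subtype.ext
        rw [hθ, integralClosure.coe_smul, integralClosure.coe_smul, hθ, he]
        rfl
      rw [map_sub, hθx]
      rw [Ideal.inertia, AddSubgroup.mem_inertia] at hτ
      exact hτ (θ x)
    rw [hf.2.2 v hv 𝔓 h𝔓 (e.symm τ) hσI, map_zero]

end FixingSubgroup

/-! ## Assembly: Prop. VIII.1.6 (`Hom` form) and Lemma X.4.3 -/

section Assembly

variable {K : Type u} [Field K]

variable (K) in
/-- **Silverman, AEC Prop. VIII.1.6 (`Hom` form): discharge of `Literature.NumberTheory.EllipticCurves.finite_unramifiedHoms`.** For a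
number field `K`, an open subgroup `U ≤ G_K`, a finite abelian group `M` and a finite set of
places `S`, `Hom(U, M; S)` is finite. Reductions as in the source: shrink `U` to
`Gal(K̄/K')` with `K' = (K̄)^U(ζ_N) ⊇ μ_N` finite over `K` (`unramifiedHoms_finite_of_le`),
decompose `M ↪ ∏ ℤ/dᵢℤ` with `dᵢ ∣ N` (`unramifiedHoms_finite_of_forall_comp`,
`exists_separating_toZMod`), and apply the cyclic case `unramifiedHoms_fixingSubgroup_finite`
(Kummer theory + finiteness of `K'(S', dᵢ)`). [cite: SilvermanAEC2009, Prop. VIII.1.6] -/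
theorem finite_unramifiedHoms_holds : finite_unramifiedHoms K := by
  intro _ U hU M _ _ _ _ S hS
  classical
  -- decomposition of `M`
  obtain ⟨ι, hι, d, N, hN, hd, hdN, π, hπ⟩ := exists_separating_toZMod M
  -- a primitive `N`-th root of unity in `K̄`
  haveI : NeZero N := ⟨hN.ne'⟩
  obtain ⟨ζ, hζ⟩ : ∃ ζ : AlgebraicClosure K, IsPrimitiveRoot ζ N := by
    obtain ⟨ζ, hζ⟩ := IsAlgClosed.exists_root (Polynomial.cyclotomic N (AlgebraicClosure K))
      (Polynomial.degree_cyclotomic_pos N _ hN).ne'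
    exact ⟨ζ, Polynomial.isRoot_cyclotomic_iff.mp hζ⟩
  -- the field `K' = (K̄)^U (ζ)`, finite over `K`
  let K₀ : IntermediateField K (AlgebraicClosure K) := IntermediateField.fixedField U
  have hK₀U : K₀.fixingSubgroup = U :=
    InfiniteGalois.fixingSubgroup_fixedField ⟨U, U.isClosed_of_isOpen hU⟩
  haveI : FiniteDimensional K K₀ := by
    rw [← InfiniteGalois.isOpen_iff_finite K₀, hK₀U]
    exact hU
  have hζint : IsIntegral K ζ :=
    IsIntegral.of_pow hN (by rw [hζ.pow_eq_one]; exact isIntegral_one)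
  haveI : FiniteDimensional K K⟮ζ⟯ := IntermediateField.adjoin.finiteDimensional hζint
  let K' : IntermediateField K (AlgebraicClosure K) := K₀ ⊔ K⟮ζ⟯
  haveI : FiniteDimensional K K' := IntermediateField.finiteDimensional_sup K₀ K⟮ζ⟯
  have hle : K'.fixingSubgroup ≤ U := by
    rw [← hK₀U]
    exact IntermediateField.fixingSubgroup_antitone le_sup_left
  let ζ' : K' := ⟨ζ, (le_sup_right : K⟮ζ⟯ ≤ K') (IntermediateField.mem_adjoin_simple_self K ζ)⟩
  have hζ' : IsPrimitiveRoot ζ' N :=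
    IsPrimitiveRoot.of_map_of_injective (f := algebraMap K' (AlgebraicClosure K)) hζ
      (algebraMap K' (AlgebraicClosure K)).injective
  -- shrink `U` to `Gal(K̄/K')`, decompose `M`, and apply the cyclic case
  refine unramifiedHoms_finite_of_le hle (U.isClosed_of_isOpen hU)
    (IntermediateField.fixingSubgroup_isOpen K') M S ?_
  letI : ∀ i, TopologicalSpace (ULift.{u} (ZMod (d i))) := fun _ ↦ ⊥
  haveI : ∀ i, DiscreteTopology (ULift.{u} (ZMod (d i))) := fun _ ↦ ⟨rfl⟩
  refine unramifiedHoms_finite_of_forall_comp π (fun i ↦ continuous_of_discreteTopology) hπ S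
    fun i ↦ ?_
  obtain ⟨c, hc⟩ := hdN i
  have hζi : IsPrimitiveRoot (ζ' ^ c) (d i) := hζ'.pow hN (by rw [hc, mul_comm])
  exact unramifiedHoms_fixingSubgroup_finite K' (hd i) hζi (ULift.{u} (ZMod (d i)))
    (AddEquiv.ulift : ULift.{u} (ZMod (d i)) ≃+ ZMod (d i)).toAddMonoidHom
    (fun x y h ↦ (AddEquiv.ulift : ULift.{u} (ZMod (d i)) ≃+ ZMod (d i)).injective h) hS

variable (K) in
/-- **Silverman, AEC Lemma X.4.3: discharge of `Literature.NumberTheory.EllipticCurves.finite_h1Unramified`.** For a number field `K`,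
a finite discrete `G_K`-module `M` with continuous action and a finite set of places `S`, the
group `H¹(G_{K̄/K}, M; S)` of classes unramified outside `S` is finite:
`Literature.NumberTheory.EllipticCurves.finite_h1Unramified_of_finite_unramifiedHoms` (inflation–restriction step, `H1UnramifiedFinite`)
applied to `finite_unramifiedHoms_holds` (Prop. VIII.1.6). [cite: SilvermanAEC2009, Lemma X.4.3] -/
theorem finite_h1Unramified_holds : finite_h1Unramified K :=
  finite_h1Unramified_of_finite_unramifiedHoms K (finite_unramifiedHoms_holds K)

end Assembly

end Literature.NumberTheory.EllipticCurves
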